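import Literature.NumberTheory.EllipticCurves.LocalRestrictionDegree
import Mathlib.FieldTheory.PrimitiveElement
import Mathlib.Order.CompleteLattice.Finset
import Mathlib.Data.Nat.Factorial.Basic
import HarnessLib

/-!
# Local kernels along a finite extension are killed by a bound depending only on the degree

The finite-degree companion of `Literature.NumberTheory.EllipticCurves.LocalRestrictionDegree`
(which treats `[L : K] ≤ 2`). For a Weierstrass curve `W` (an elliptic curve `E`) over a number
field `K` and a finite extension `L/K` of degree `≤ d`:

* `finrank_finGaloisClosure_le_pow` — for a finite separable extension `E'/E` of degree `n`, the
  Galois closure `Ẽ'` of `E'/E` inside `Ē` (the tree's `finGaloisClosure`, Mathlib's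
  `normalClosure = ⨆_f f(E')` over the `n` embeddings `f : E' → Ē`, `AlgHom.card`) has degree
  `[Ẽ' : E] ≤ n ^ n` (`IntermediateField.finrank_sup_le`, by induction over the embeddings); so
  the index `[Γ_E : Γ_{Ẽ'}]` divides `(d ^ d)!` whenever `n ≤ d`
  (`index_finGalSubgroup_dvd_factorial`) — a crude but *uniform* bound;
* `factorial_nsmul_mem_localRestrictionKer_of_tower` — hence a class of `H¹(K, E)` dying in
  `H¹(E', E)`, `[E' : E] ≤ d`, is killed by `(d ^ d)!` in `H¹(E, E)` (the tree's
  `index_nsmul_mem_localRestrictionKer_of_tower`: the kernel of `H¹(E, ·) → H¹(E', ·)` is inflated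
  from `Gal(Ẽ'/E)` and killed by its order);
* `localDegreeBound d = 2 · (d ^ d)!` and
  `localDegreeBound_nsmul_mem_sha_of_resBaseChange_mem_sha`,
  `localDegreeBound_nsmul_mem_selmerGroupPInfty_of_res_mem` — **if `res x ∈ Ш(E_L/L)` then
  `B(d) x ∈ Ш(E/K)`**, and the same for `Sel_{p^∞}`, with `B(d) = localDegreeBound d`: at a
  finite place `v` of `K` pick `w ∣ v` of `L`, `[L_w : K_v] ≤ [L : K] ≤ d`
  (`finrank_adicCompletion_le_of_liesOver`), so `(d ^ d)! x` dies at `v`; at an infinite place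
  `2 x` dies (`[L_w : K_v] ≤ 2`, `finrank_completion_le_two`).

This is the local half of "the cokernel of `Sel_{p^∞}(E/K) → Sel_{p^∞}(E/F)^G` is killed by a
power of `|G|`" in Dokchitser–Dokchitser, Ann. of Math. 172 (2010), proof of Lemma 4.14, for a
finite extension `F/K` of arbitrary degree (only the existence of a uniform bound matters for the
corank statements). Everything here is proved; no named fact is introduced.

## References

* T. Dokchitser, V. Dokchitser, Ann. of Math. 172 (2010), Lemma 4.14 (proof).
  [DokchitserDokchitserAnnals2010]
* J.-P. Serre, *Galois Cohomology* (1997), I.§2.4 (Cor. to Prop. 9), II.§1.1.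
  [SerreGaloisCohomology1997]
-/

noncomputable section

open scoped Classical

universe u

namespace Literature.NumberTheory.EllipticCurves

open GaloisRepresentations WeierstrassCurve IntermediateField

/-! ## A uniform bound for the degree of the Galois closure of an extension of degree `≤ d` -/

section FinClosureBound

variable {E : Type u} [Field E] (E' : Type u) [Field E'] [Algebra E E'] [FiniteDimensional E E']

omit [FiniteDimensional E E'] in
/-- The image `f(E')` of a finite extension `E'/E` under an `E`-embedding into a field `L` has
degree `[f(E') : E] = [E' : E]` (`f : E' ≃ f(E')`, Mathlib `IntermediateField.equivMap`).
[folklore] -/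
theorem finrank_fieldRange_eq {L : Type*} [Field L] [Algebra E L] (f : E' →ₐ[E] L) :
    Module.finrank E f.fieldRange = Module.finrank E E' := by
  rw [AlgHom.fieldRange_eq_map,
    ← (IntermediateField.equivMap (⊤ : IntermediateField E E') f).toLinearEquiv.finrank_eq,
    IntermediateField.finrank_top']

omit [FiniteDimensional E E'] in
/-- The compositum of the images of `E'` under finitely many `E`-embeddings `f ∈ s` has degree
`≤ [E' : E] ^ #s` (`IntermediateField.finrank_sup_le`, induction on `s`). [folklore] -/
theorem finrank_biSup_fieldRange_le {L : Type*} [Field L] [Algebra E L] (s : Finset (E' →ₐ[E] L)) :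
    Module.finrank E (⨆ f ∈ s, f.fieldRange : IntermediateField E L) ≤
      Module.finrank E E' ^ s.card := by
  induction s using Finset.induction_on with
  | empty =>
    rw [Finset.card_empty, pow_zero]
    have h : (⨆ f ∈ (∅ : Finset (E' →ₐ[E] L)), f.fieldRange : IntermediateField E L) = ⊥ := by
      simp
    rw [h, IntermediateField.finrank_bot]
  | insert a s ha ih =>
    rw [Finset.iSup_insert, Finset.card_insert_of_notMem ha, pow_succ']
    exact (IntermediateField.finrank_sup_le _ _).trans
      (Nat.mul_le_mul (finrank_fieldRange_eq E' a).le ih)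

/-- **`[Ẽ' : E] ≤ n ^ n`** for a finite separable extension `E'/E` of degree `n`: the Galois
closure `Ẽ'` of `E'` in `Ē` is the compositum of the `n` conjugates `f(E')`, `f : E' → Ē`
(`normalClosure_def`, `AlgHom.card`), each of degree `n`. [folklore] -/
theorem finrank_finGaloisClosure_le_pow [Algebra.IsSeparable E E'] :
    Module.finrank E (finGaloisClosure (E := E) E') ≤
      Module.finrank E E' ^ Module.finrank E E' := by
  have h : (finGaloisClosure (E := E) E' : IntermediateField E (AlgebraicClosure E)) =
      ⨆ f ∈ (Finset.univ : Finset (E' →ₐ[E] AlgebraicClosure E)), f.fieldRange := by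
    unfold finGaloisClosure
    rw [normalClosure_def]
    simp
  rw [h]
  refine (finrank_biSup_fieldRange_le E' _).trans ?_
  rw [Finset.card_univ, AlgHom.card]

variable [CharZero E]

/-- `[Γ_E : Γ_{Ẽ'}] = [Ẽ' : E] ≤ [E' : E] ^ [E' : E]` (characteristic `0`). [folklore] -/
theorem index_finGalSubgroup_le_pow :
    (finGalSubgroup (E := E) E').index ≤ Module.finrank E E' ^ Module.finrank E E' := by
  rw [index_finGalSubgroup_eq]
  exact finrank_finGaloisClosure_le_pow E'

/-- **A uniform bound**: if `[E' : E] ≤ d` then `[Γ_E : Γ_{Ẽ'}]` divides `(d ^ d)!`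
(it is a positive integer `≤ [E' : E]^[E' : E] ≤ d ^ d`). [folklore] -/
theorem index_finGalSubgroup_dvd_factorial {d : ℕ} (h : Module.finrank E E' ≤ d) :
    (finGalSubgroup (E := E) E').index ∣ (d ^ d).factorial := by
  have hn : 0 < Module.finrank E E' := Module.finrank_pos
  have hd : 0 < d := hn.trans_le h
  refine Nat.dvd_factorial (Nat.pos_of_ne_zero Subgroup.FiniteIndex.index_ne_zero) ?_
  calc (finGalSubgroup (E := E) E').index
      ≤ Module.finrank E E' ^ Module.finrank E E' := index_finGalSubgroup_le_pow E'
    _ ≤ d ^ Module.finrank E E' := Nat.pow_le_pow_left h _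
    _ ≤ d ^ d := Nat.pow_le_pow_right hd h

end FinClosureBound

/-! ## Towers: a class dying over `E'`, `[E' : E] ≤ d`, dies over `E` after `(d ^ d)!` -/

section Tower

variable {K : Type u} [Field K] (W : WeierstrassCurve K)
variable {E : Type u} [Field E] [Algebra K E]
variable {E' : Type u} [Field E'] [Algebra K E'] [Algebra E E'] [IsScalarTower K E E']
variable [FiniteDimensional E E'] [CharZero E]

/-- **For `[E' : E] ≤ d`, a class of `H¹(K, E)` dying over `E'` dies over `E` after
multiplication by `(d ^ d)!`** (`index_nsmul_mem_localRestrictionKer_of_tower` with the uniform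
bound `index_finGalSubgroup_dvd_factorial`). Serre, *Galois Cohomology*, I.§2.4, Cor. to Prop. 9.
[cite: SerreGaloisCohomology1997, I.§2.4 Cor. to Prop. 9] -/
theorem factorial_nsmul_mem_localRestrictionKer_of_tower {d : ℕ} (h : Module.finrank E E' ≤ d)
    {c : W.galH1} (hc : c ∈ W.localRestrictionKer E') :
    (d ^ d).factorial • c ∈ W.localRestrictionKer E := by
  obtain ⟨k, hk⟩ := index_finGalSubgroup_dvd_factorial (E := E) E' h
  rw [hk, mul_nsmul]
  exact AddSubgroup.nsmul_mem _ (index_nsmul_mem_localRestrictionKer_of_tower (E := E) W hc) k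

end Tower

/-! ## Finite extensions of number fields: `res x ∈ Ш(E_L/L) ⇒ B([L:K]) x ∈ Ш(E/K)` -/

section NumberField

open NumberField IsDedekindDomain

/-- The uniform local bound `B(d) = 2 · (d ^ d)!` for an extension of degree `≤ d`: `(d ^ d)!`
for the finite places (`index_finGalSubgroup_dvd_factorial`, `[L_w : K_v] ≤ d`) and `2` for the
infinite ones (`[L_w : K_v] ≤ 2`). Only its existence and positivity matter. [folklore] -/
def localDegreeBound (d : ℕ) : ℕ :=
  2 * (d ^ d).factorial

/-- `B(d) > 0`. [folklore] -/
theorem localDegreeBound_pos (d : ℕ) : 0 < localDegreeBound d :=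
  Nat.mul_pos two_pos (Nat.factorial_pos _)

/-- `B(d) ≠ 0`. [folklore] -/
theorem localDegreeBound_ne_zero (d : ℕ) : localDegreeBound d ≠ 0 :=
  (localDegreeBound_pos d).ne'

variable {K : Type u} [Field K] [NumberField K] (W : WeierstrassCurve K)
variable (L : Type u) [Field L] [NumberField L] [Algebra K L]

/-- **If `res x ∈ Ш(E_L/L)` for an extension `L/K` of degree `≤ d` then `B(d) x ∈ Ш(E/K)`.** At a
finite place `v` of `K` pick a place `w` of `L` above it; `res x` dies in `H¹(L_w, E_L)`, i.e.
`x` dies in `H¹(L_w, E)` (`mem_localRestrictionKer_iff_resBaseChange_mem`), hence `(d ^ d)! x`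
dies in `H¹(K_v, E)` (`factorial_nsmul_mem_localRestrictionKer_of_tower`,
`[L_w : K_v] ≤ [L : K] ≤ d`); at an infinite place `2 x` dies
(`two_nsmul_mem_localRestrictionKer_of_tower`, `[L_w : K_v] ≤ 2`). This is the local half of
"the cokernel of `Sel(E/K) → Sel(E/F)^G` is killed by a power of `|G|`" (Dokchitser–Dokchitser
2010, proof of Lemma 4.14), for `F/K` of any finite degree.
[cite: DokchitserDokchitserAnnals2010, Lemma 4.14 (proof)] -/
theorem localDegreeBound_nsmul_mem_sha_of_resBaseChange_mem_sha {d : ℕ}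
    (hd : Module.finrank K L ≤ d) {x : W.galH1} (hx : resBaseChange W L x ∈ (W.baseChange L).sha) :
    localDegreeBound d • x ∈ W.sha := by
  rw [WeierstrassCurve.mem_sha_iff] at hx ⊢
  refine ⟨fun v ↦ ?_, fun v ↦ ?_⟩
  · -- finite places
    obtain ⟨w, hw⟩ := exists_liesOver L v
    haveI := hw
    obtain ⟨hfin, hle⟩ := finrank_adicCompletion_le_of_liesOver L v w
    letI : Algebra (v.adicCompletion K) (w.adicCompletion L) :=
      (adicCompletionMap (K := K) L v w).toAlgebra
    haveI : IsScalarTower K (v.adicCompletion K) (w.adicCompletion L) :=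
      IsScalarTower.of_algebraMap_eq fun x ↦ (adicCompletionMap_coe (K := K) L v w x).symm
    haveI : FiniteDimensional (v.adicCompletion K) (w.adicCompletion L) := hfin
    haveI : CharZero (v.adicCompletion K) :=
      charZero_of_injective_algebraMap (algebraMap K (v.adicCompletion K)).injective
    have hx' : x ∈ W.localRestrictionKer (w.adicCompletion L) :=
      (mem_localRestrictionKer_iff_resBaseChange_mem W x).mpr (hx.1 w)
    have hfac := factorial_nsmul_mem_localRestrictionKer_of_tower W (E := v.adicCompletion K)
      (hle.trans hd) hx'
    rw [localDegreeBound, mul_comm, mul_nsmul]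
    exact AddSubgroup.nsmul_mem _ hfac 2
  · -- infinite places
    obtain ⟨w, hw⟩ := InfinitePlace.comap_surjective (k := K) (K := L) v
    subst hw
    set v : InfinitePlace K := w.comap (algebraMap K L)
    haveI : w.1.LiesOver v.1 := ⟨rfl⟩
    obtain ⟨hfin, hle⟩ := finrank_completion_le_two (K := K) L v w
    haveI : IsScalarTower K L w.Completion := IsScalarTower.of_algebraMap_eq fun x ↦ by
      apply NumberField.InfinitePlace.Completion.ext
      rw [NumberField.InfinitePlace.Completion.algebraMap_toCompletion,
        NumberField.InfinitePlace.Completion.algebraMap_toCompletion,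
        UniformSpace.Completion.algebraMap_def, UniformSpace.Completion.algebraMap_def,
        IsScalarTower.algebraMap_apply K L (WithAbs w.1)]
    letI : Algebra v.Completion w.Completion := NumberField.LiesOver.instAlgebraCompletion
    haveI : IsScalarTower K v.Completion w.Completion :=
      NumberField.LiesOver.instIsScalarTowerCompletion
    haveI : FiniteDimensional v.Completion w.Completion := hfin
    haveI : CharZero v.Completion :=
      charZero_of_injective_algebraMap (algebraMap K v.Completion).injective
    have hx' : x ∈ W.localRestrictionKer w.Completion :=
      (mem_localRestrictionKer_iff_resBaseChange_mem W x).mpr (hx.2 w)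
    have htwo := two_nsmul_mem_localRestrictionKer_of_tower W (E := v.Completion) hle hx'
    rw [localDegreeBound, mul_nsmul]
    exact AddSubgroup.nsmul_mem _ htwo _

/-- **If `res η ∈ Sel_{p^∞}(E_L/L)` for an extension `L/K` of degree `≤ d` then
`B(d) η ∈ Sel_{p^∞}(E/K)`** (for any map `r : H¹(K, E[p^∞]) → H¹(L, E_L[p^∞])` covering the
restriction `H¹(K, E) → H¹(L, E_L)`, e.g. the tree's `resPrimary`): the Selmer groups are the
preimages of `Ш` (`selmerGroupPInfty_eq_comap_sha`). Dokchitser–Dokchitser 2010, proof of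
Lemma 4.14. [cite: DokchitserDokchitserAnnals2010, Lemma 4.14 (proof)] -/
theorem localDegreeBound_nsmul_mem_selmerGroupPInfty_of_res_mem {d : ℕ}
    (hd : Module.finrank K L ≤ d) (p : ℕ)
    (r : galH1Primary W p →+ galH1Primary (W.baseChange L) p)
    (hr : ∀ η, primaryH1ToH1 (W.baseChange L) p (r η) = resBaseChange W L (primaryH1ToH1 W p η))
    {η : galH1Primary W p} (hη : r η ∈ selmerGroupPInfty (W.baseChange L) p) :
    localDegreeBound d • η ∈ selmerGroupPInfty W p := by
  rw [selmerGroupPInfty_eq_comap_sha, AddSubgroup.mem_comap] at hη ⊢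
  rw [hr] at hη
  rw [map_nsmul]
  exact localDegreeBound_nsmul_mem_sha_of_resBaseChange_mem_sha W L hd hη

end NumberField

end Literature.NumberTheory.EllipticCurves
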